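import Mathlib
import HarnessLib
import Summits.NavierStokesRegularity.NavierStokesRegularity.Theorems.ChiralWindowDoorDefs
import Summits.NavierStokesRegularity.NavierStokesRegularity.Theorems.CriticalFluxDoorDefs
import Summits.NavierStokesRegularity.NavierStokesRegularity.Theorems.CriticalFluxDoorTargetOfF2F3
import Summits.NavierStokesRegularity.NavierStokesRegularity.Theorems.CriticalFluxDoorCritDissipationLower
import Summits.NavierStokesRegularity.NavierStokesRegularity.Theorems.CriticalFluxDoorCritEnergyBudget

/-!
# Door S21-C «CriticalFluxDoor» (nsreg-p1 ROUND-20, design-only) — THE DOOR CLOSED: residue, crux K2 and `Target`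
# UNCONDITIONALLY (texts verbatim from `r20/Sketch21v3.lean`)

Door S21-C of nsreg-p1's local Type-I door family (`HOME/ns-regularity-ideate-p1/ROUND-20.md`; DESIGN-ONLY, route NOT
born).  The compositions of `…CriticalFluxDoorTargetOfF2F3` (residue / K2 / `Target` from the texts of F2 and F3) are
fed the two stubs, now tree theorems:
F2 = `…CriticalFluxDoorCritDissipationLower.critDissipationLower`,
F3 = `…CriticalFluxDoorCritEnergyBudget.critEnergyBudget`.

* `fluxFreeProfileRigidityEverywhere` — support `FluxFreeProfileRigidityEverywhere` (text verbatim): a door-class profile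
  whose critical flux density `⟪Λv, (v·∇)v⟫` vanishes identically at all negative times is not backward-singular at `0`;
* `fluxFreeProfileRigidity` — crux K2 `FluxFreeProfileRigidity` (text verbatim): the same under vanishing on an open
  window at each negative time;
* `criticalFluxDoor_target` — **the door `Target` (text verbatim)**: a Leray–Hopf / classical solution which is locally
  Type I near `(x₀, T)` and whose rescaled critical flux fades on an open window is backward-bounded at `(x₀, T)`.

Seat nsreg-p6 g13 (THEOREMS-ONLY door sequels, DIRECTOR-NS g8 #32 (2)/#36); texts by nsreg-p1 g17.  WHAT THIS IS NOT:
not NS regularity (Clay A) — a conditional local criterion (flux-window hypothesis) of the door family; no route is opened.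
-/

noncomputable section

-- the summit and its single sub-problem share the name (CONVENTIONS §1), as in every Theorems file
set_option linter.dupNamespace false

namespace Summit.NavierStokesRegularity.NavierStokesRegularity.Theorems.CriticalFluxDoorDoor

open MeasureTheory Set Function Filter Topology Metric
open scoped RealInnerProductSpace NNReal ENNReal
open Literature.Analysis Literature.Analysis.FluidPDE
open Summit.NavierStokesRegularity.NavierStokesRegularity.Theorems.ChiralWindowDoorDefs
open Summit.NavierStokesRegularity.NavierStokesRegularity.Theorems.CriticalFluxDoorDefs
open Summit.NavierStokesRegularity.NavierStokesRegularity.Theorems.CriticalFluxDoorTargetOfF2F3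
  (fluxFreeProfileRigidityEverywhere_of_F2_F3 fluxFreeProfileRigidity_of_F2_F3 target_of_F2_F3)
open Summit.NavierStokesRegularity.NavierStokesRegularity.Theorems.CriticalFluxDoorCritDissipationLower
  (critDissipationLower)
open Summit.NavierStokesRegularity.NavierStokesRegularity.Theorems.CriticalFluxDoorCritEnergyBudget
  (critEnergyBudget)

/-- **Support `FluxFreeProfileRigidityEverywhere` of `r20/Sketch21v3.lean` (text verbatim), UNCONDITIONAL**: a door-class
profile with `fluxDensity (v t) ≡ 0` for all `t < 0` is not backward-singular at time `0`. -/
theorem fluxFreeProfileRigidityEverywhere :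
    ∀ (C D : ℝ) (v : ℝ → EuclideanSpace ℝ (Fin 3) → EuclideanSpace ℝ (Fin 3)), Literature.Analysis.FluidPDE.HasTypeITimeDecay C v → Literature.Analysis.FluidPDE.HasTypeIDecay D v → ContinuousOn (Function.uncurry v) (Set.Iio (0 : ℝ) ×ˢ Set.univ) → (∀ s t : ℝ, s < t → t < 0 → ∀ x, v t x = Literature.Analysis.UnboundedOperators.heatExtension (v s) (t - s) x - Literature.Analysis.FluidPDE.oseenDuhamel 1 s v v t x) → (∀ t < 0, Literature.Analysis.FluidPDE.VectorCalculus.IsDivFree (v t)) → (∀ t < 0, IsFluxFree (v t)) → ¬ Literature.Analysis.FluidPDE.IsBackwardSingularPoint v 0 :=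
  fluxFreeProfileRigidityEverywhere_of_F2_F3 critDissipationLower critEnergyBudget

/-- **Crux K2 `FluxFreeProfileRigidity` of `r20/Sketch21v3.lean` (text verbatim), UNCONDITIONAL**: a door-class profile
whose critical flux density vanishes on a non-empty open window at every negative time is not backward-singular at `0`. -/
theorem fluxFreeProfileRigidity :
    ∀ (C D : ℝ) (v : ℝ → EuclideanSpace ℝ (Fin 3) → EuclideanSpace ℝ (Fin 3)), Literature.Analysis.FluidPDE.HasTypeITimeDecay C v → Literature.Analysis.FluidPDE.HasTypeIDecay D v → ContinuousOn (Function.uncurry v) (Set.Iio (0 : ℝ) ×ˢ Set.univ) → (∀ s t : ℝ, s < t → t < 0 → ∀ x, v t x = Literature.Analysis.UnboundedOperators.heatExtension (v s) (t - s) x - Literature.Analysis.FluidPDE.oseenDuhamel 1 s v v t x) → (∀ t < 0, Literature.Analysis.FluidPDE.VectorCalculus.IsDivFree (v t)) → (∀ s < 0, ∃ U : Set (EuclideanSpace ℝ (Fin 3)), IsOpen U ∧ U.Nonempty ∧ ∀ z ∈ U, fluxDensity (v s) z = 0) → ¬ Literature.Analysis.FluidPDE.IsBackwardSingularPoint v 0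 :=
  fluxFreeProfileRigidity_of_F2_F3 critDissipationLower critEnergyBudget

/-- **The door `Target` of S21-C «CriticalFluxDoor» (`r20/Sketch21v3.lean`, text verbatim), UNCONDITIONAL**: for a
classical / Leray–Hopf solution on `[0,T)` with rapidly decaying data, locally Type I near `(x₀,T)`, whose rescaled
critical flux density fades on a non-empty open window as `t ↑ T`, the solution is backward-bounded at `(x₀,T)`. -/
theorem criticalFluxDoor_target :
    ∀ (ν T : ℝ), 0 < ν → 0 < T → ∀ (u : ℝ → EuclideanSpace ℝ (Fin 3) → EuclideanSpace ℝ (Fin 3)) (p : ℝ → EuclideanSpace ℝ (Fin 3) → ℝ), Literature.Analysis.FluidPDE.IsClassicalNSSolutionOn (Set.Ico 0 T) ν 0 u p → Literature.Analysis.FluidPDE.IsLerayHopfOn T ν 0 (u 0) u → Literature.Analysis.FluidPDE.HasRapidSpatialDecay (u 0) → ∀ (x₀ : EuclideanSpace ℝ (Fin 3)) (ρ M : ℝ), 0 < ρ → (∀ t ∈ Set.Ico 0 T, T - ρ ^ 2 < t → ∀ x ∈ Metric.ball x₀ ρ, ‖u t x‖ * (‖x - x₀‖ + Real.sqrt (ν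 * (T - t))) ≤ M) → ∀ (U : Set (EuclideanSpace ℝ (Fin 3))), IsOpen U → U.Nonempty → Filter.Tendsto (fun t => ∫⁻ y in U, ENNReal.ofReal (Real.sqrt (T - t) ^ 5 * |fluxDensity (u t) (x₀ + Real.sqrt (T - t) • y)|)) (nhdsWithin T (Set.Iio T)) (nhds 0) → Literature.Analysis.FluidPDE.IsBackwardBoundedAt u T x₀ :=
  target_of_F2_F3 critDissipationLower critEnergyBudget

end Summit.NavierStokesRegularity.NavierStokesRegularity.Theorems.CriticalFluxDoorDoor

end
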